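import Summits.QuantumAdvantage.AdviceFreeQNC0.MassInequalityK
import HarnessLib

/-!
# Cell qa-qnc0 (rung F-Q1, density axis, crux of record `TensorMultOneAt` = MULT₁): the REGIMES of the mass
# inequality — Sketch13 v6c/v6d/(xi-t)/(xi-v′)/(xi-w) statements VERBATIM and `miChainFifteen`
# (the proofs `pairDomPays`, `pairDomPaysK`, `oneWordDecode` follow in `MassInequalityRegimesProofs.lean`)

Planner qa-qnc0-p1 gen 13/14 (`HOME/qa-qnc0-p1/MassInequalityK.lean`, ROUND-12 §2.10 (xi-o)–(xi-w); ask L29 = land it).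
The v6b/v6e part (`distTo`, `bracketK`, `MassIneqK`, `MassIneqAll`, `MassIneqKPays`, `LightMassK`, `MIChainFifteen`,
`DisjointDom`, `DomPays` + `domPays` PROVED, `DomFive/Six/Seven`, `ExactMultSeven`) is qa-qnc0-prover-2's
`MassInequalityK.lean`; this file lands the REST of the planner's file verbatim and proves the pair-domination regime:

* `miChainFifteen : MIChainFifteen` (the paying chain at m = 15 is pure logic; proof verbatim);
* §NearOutside / §NearOutsideK — `NearOutMass`, `IsDualVec`, `SuppOut`, `DualGenOut`, `OutDetermines`, `NearOutLemma`
  (provable now, M), `NearOutEight`, `NearOutMassK`, `NearOutLemmaK` (statements);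
* §PairDomination — `PairCover`, `PairDomPays`, `PairCoverK`, `PairDomPaysK` (statements; PROVED for every `m` in
  `MassInequalityRegimesProofs.lean`: the third proved regime of MI, (xi-t));
* §OneWord — `IsMinWord`, `SuppCols`, `OneWordMIAt` (OPEN at m = 8), `OneWordDecode` (PROVED in the Proofs file),
  `oneWordMIAt_of_massIneqAt`; §Margin — `SCMargin`, `SCMarginSeven`, `SCMarginNine`, `MinWordIsOptDiffEight`;
  §DualGenFifteen — `DualGenOutFifteen`, `DualGenOutFourteen` (finite facts, kit j277896 / j277899).

WHAT THIS IS NOT: statements only apart from `miChainFifteen` / `oneWordMIAt_of_massIneqAt` (pure logic); `NearOutLemma(K)`,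
`MassIneqKPays`, the SC-margins and the DualGenOut certificates are NOT proved; `OneWordMIAt 8`, MI and MULT₁ are OPEN;
nothing on crux α; separation NOT moved.
-/

namespace Summit.QuantumAdvantage.AdviceFreeQNC0

open Finset
open Literature.Computability.MetaComplexity Literature.Computability.MetaComplexity.Smolensky

namespace MassInequality

/-! ### The paying chain at m = 15 (Sketch13 v6b, proof verbatim) -/

/-- The chain is pure logic (kernel-checked). -/
theorem miChainFifteen : MIChainFifteen := by
  rintro ⟨K0, hopt, hsym, hfc⟩ hall hpays
  have hmi : ∀ k, 0 < k → MassIneqK 15 k K0 := fun k hk => hall K0 hopt hsym k hk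
  have ht := hpays K0 hopt hmi
  refine ⟨15, (failCount K0 : ℝ) / (2 : ℝ) ^ 15, ?_, ht⟩
  have h' : ((2 ^ 15 : ℕ) : ℝ) < ((4 * failCount K0 : ℕ) : ℝ) := by exact_mod_cast hfc
  push_cast at h'
  rw [lt_div_iff₀ (by positivity)]
  linarith


/-! ### v6c (11:50Z): the NEAR-OUTSIDE regime (ROUND-12 §2.10 (xi-o)) — a second PROVED region of MI.
Write `δ_u = c_u + ε_u` with `c_u ∈ C_m` nearest, for OUTSIDE rows only. A linear relation among outside
points `Σ_{u∈R} x(u) = 0` (`R` = support of a dual word inside `Z^c`) forces `Σ_R ε_u ∈ C_m`, hence `= 0`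
as soon as `|R|·ρ < d(C_m)`. If the dual words inside `Z^c` of length `≤ L` GENERATE all of them
(m = 8: L = 6 — the 56 175 length-4 words give rank 186/193, length 6 completes 193/193, kit13/outrel.py)
and `L·ρ < d(C_m)` (m = 8: ρ ≤ 9), then `ε` extends to a LINEAR map `x ↦ Lx`; every inside row is
`c + L x(z)` (outside points determine everything since `|Z| < d(C_m)`), so `d(δ_z, C) ≤ |L x(z)|` while
`d(δ_u, C) = |L x(u)|` outside, and `bracket ≥ Σ_v (|A_v∖Z| − |A_v∩Z|) ≥ 0` by SC₁, where `A_v(u) = (L x(u))_v`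
IS A CODEWORD. So: MI(8) holds for every deviation whose OUTSIDE rows are within distance 9 of `C_8` — inside
rows, ranks and weights unrestricted (`NearOutEight`). At odd m the SC₁ slack `σ_m = d(C_m) − w(m,1)`
(13, 40, 121, 364, 1093 for m = 7, 9, 11, 13, 15) extends this to deviations with at most `σ_m` far outside rows. -/

section NearOutside

/-- MI in the near-outside regime of radius `ρ` at `K0`: only OUTSIDE rows are constrained. -/
def NearOutMass (m ρ : ℕ) (K0 : (Fin m → Bool) → Bool) : Prop :=
  ∀ D, ColsInC m D → (∀ u, K0 u = true → distC m (D u) ≤ ρ) → 0 ≤ bracket m K0 D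

/-- `r` is (the indicator of) a DUAL word of `C_m`: even overlap with every codeword. -/
def IsDualVec (m : ℕ) (r : (Fin m → Bool) → ZMod 2) : Prop :=
  ∀ A, IsElim1 m A → (∑ u : Fin m → Bool, (if A u = true then r u else 0)) = 0

/-- `r` is supported outside `Z(K0)`. -/
def SuppOut {m : ℕ} (K0 : (Fin m → Bool) → Bool) (r : (Fin m → Bool) → ZMod 2) : Prop :=
  ∀ u, r u ≠ 0 → K0 u = true

/-- The dual words supported outside `Z` are generated by those of length `≤ L` (m = 8, symmetric optimum: L = 6). -/
def DualGenOut (m : ℕ) (K0 : (Fin m → Bool) → Bool) (L : ℕ) : Prop :=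
  ∀ r, IsDualVec m r → SuppOut K0 r →
    r ∈ Submodule.span (ZMod 2)
      {r' : (Fin m → Bool) → ZMod 2 | IsDualVec m r' ∧ SuppOut K0 r' ∧
        (univ.filter fun u : Fin m → Bool => r' u ≠ 0).card ≤ L}

/-- Outside points determine codewords: no non-zero codeword vanishes on all of `Z^c` (automatic from `|Z| < d(C_m)`). -/
def OutDetermines (m : ℕ) (K0 : (Fin m → Bool) → Bool) : Prop :=
  ∀ A, IsElim1 m A → (∀ u, K0 u = true → A u = false) → ∀ u, A u = false

/-- **NEAR-OUTSIDE LEMMA** (linear extension + SC₁; provable now, M). -/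
def NearOutLemma (m : ℕ) : Prop :=
  ∀ K0 (L ρ : ℕ), SC1At m K0 → OutDetermines m K0 → DualGenOut m K0 L →
    (∀ Q, IsElim1 m Q → pwt Q ≠ 0 → L * ρ < pwt Q) → NearOutMass m ρ K0

/-- Rung (m = 8, ρ = 9; finite facts: SC₁(8), L = 6, d(C_8) = 58, all verified by kit13 scripts): MI(8) for every
deviation whose outside rows are within distance 9 of `C_8`. -/
def NearOutEight : Prop := ∀ K0, IsOpt1 8 K0 → IsSymPat K0 → NearOutMass 8 9 K0

end NearOutside

/-! ### v6d (11:55Z): the near-outside lemma at every level (decode outside rows to `S_k`; `d(S_k) = d(C_m)`;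
`A_v(u) = (L x(u))_v` is still a codeword in `u`). -/

section NearOutsideK

/-- Near-outside MI at level `k+1` (outside rows within `ρ` of the `k`-block sum code). -/
def NearOutMassK (m k ρ : ℕ) (K0 : (Fin m → Bool) → Bool) : Prop :=
  ∀ D, ColsInCK m k D →
    (∀ u, K0 u = true → distTo (SumCodeWin (m * k) k 1) (D u) ≤ ρ) → 0 ≤ bracketK m k K0 D

/-- **NEAR-OUTSIDE LEMMA, level-uniform** (provable now, M): the radius condition is against the minimum
weight of the `k`-block sum code (`= d(C_m)`, attained by `c ⊗ δ_{v₀}`). -/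
def NearOutLemmaK (m : ℕ) : Prop :=
  ∀ K0 (L ρ k : ℕ), 0 < k → SC1At m K0 → OutDetermines m K0 → DualGenOut m K0 L →
    (∀ Q, SumCodeWin (m * k) k 1 Q → pwt Q ≠ 0 → L * ρ < pwt Q) → NearOutMassK m k ρ K0

end NearOutsideK

/-! ### (xi-t) (12:25Z): PAIR DOMINATION — a third proved regime, covering COARSE type maps with ARBITRARY (far) rows.
If every inside row is the XOR of two OUTSIDE rows, `D z = D (p z) ⊕ D (q z)`, with the pairs `{p z, q z}` pairwise disjoint,
then subadditivity of the distance to the (linear) sum code gives `Σ_in ≤ Σ_out`, i.e. MI — whatever the row weights.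
Counting: needs `2w ≤ 2^m − w`, true for every m (w/2^m → 0.267); TRIPLE domination needs `3w ≤ 2^m − w ⟺ w/2^m ≤ 1/4`,
i.e. exactly when the block does NOT pay — the counting thresholds align with the payoff threshold.  Pairs exist in abundance
when the type map `u ↦ (A_1(u),…,A_r(u))` of `D = Σ A_i ⊗ g_i` has balanced classes (small rank r); none exist at full rank
(no weight-3 dual words), which is the far regime proper. -/

section PairDomination

/-- An integral disjoint PAIR COVER of the inside rows of `D` by outside rows. -/
def PairCover (m : ℕ) (K0 : (Fin m → Bool) → Bool) (D : (Fin m → Bool) → (Fin m → Bool) → Bool) : Prop :=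
  ∃ p q : (Fin m → Bool) → (Fin m → Bool),
    (∀ z, K0 z = false →
        K0 (p z) = true ∧ K0 (q z) = true ∧ p z ≠ q z ∧ ∀ v, D z v = xor (D (p z) v) (D (q z) v)) ∧
    (∀ z z', K0 z = false → K0 z' = false → z ≠ z' →
        p z ≠ p z' ∧ p z ≠ q z' ∧ q z ≠ p z' ∧ q z ≠ q z')

/-- **PAIR DOMINATION PAYS** (provable now, S): `distC` is subadditive under `xor` (the one-block code is closed under
`xor`, `isElim1_xor`), so `distC (D z) ≤ distC (D (p z)) + distC (D (q z))`; disjointness sums to `0 ≤ bracket`. -/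
def PairDomPays (m : ℕ) : Prop := ∀ K0 D, PairCover m K0 D → 0 ≤ bracket m K0 D

/-- Level-`k+1` version (rows indexed by `u`, columns by the `k` context blocks). -/
def PairCoverK (m k : ℕ) (K0 : (Fin m → Bool) → Bool)
    (D : (Fin m → Bool) → (Fin (m * k) → Bool) → Bool) : Prop :=
  ∃ p q : (Fin m → Bool) → (Fin m → Bool),
    (∀ z, K0 z = false →
        K0 (p z) = true ∧ K0 (q z) = true ∧ p z ≠ q z ∧ ∀ v, D z v = xor (D (p z) v) (D (q z) v)) ∧
    (∀ z z', K0 z = false → K0 z' = false → z ≠ z' →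
        p z ≠ p z' ∧ p z ≠ q z' ∧ q z ≠ p z' ∧ q z ≠ q z')

/-- provable now (S): `distTo S` is subadditive for the xor-closed sum code `S = SumCodeWin (m*k) k 1`. -/
def PairDomPaysK (m : ℕ) : Prop := ∀ K0 k D, 0 < k → PairCoverK m k K0 D → 0 ≤ bracketK m k K0 D

end PairDomination

/-! ## ONE-WORD MI (ROUND-12 (xi-v′)) — the minimal far-regime instance
Deviations supported on the columns of a MINIMUM-weight codeword `c`: for such `D` every row `R_u ⊆ supp c`
decodes exactly, `distC (D u) = min (r_u, pwt c - r_u)`, so `MassIneqAt m K0` restricted to this family is an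
elementary inequality about `C_m`, `K0` and `c`.  SC₁ (first moments) proves it only up to a factor 2. -/
section OneWord

/-- `c` is a nonzero codeword of minimum weight. -/
def IsMinWord (m : ℕ) (c : (Fin m → Bool) → Bool) : Prop :=
  IsElim1 m c ∧ pwt c ≠ 0 ∧ ∀ Q, IsElim1 m Q → pwt Q ≠ 0 → pwt c ≤ pwt Q

/-- `D` is supported on the columns of `c`. -/
def SuppCols (m : ℕ) (c : (Fin m → Bool) → Bool) (D : (Fin m → Bool) → (Fin m → Bool) → Bool) : Prop :=
  ∀ u v, c v = false → D u v = false

/-- **ONE-WORD MI at `K0`**: the mass inequality for column-codeword deviations supported on one minimum word.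
A special case of `MassIneqAt m K0`; OPEN at `m = 8` (kit j278363 searches for violations); lemma target. -/
def OneWordMIAt (m : ℕ) (K0 : (Fin m → Bool) → Bool) : Prop :=
  ∀ c, IsMinWord m c → ∀ D, ColsInC m D → SuppCols m c D → 0 ≤ bracket m K0 D

/-- Exact decoding inside one minimum word (provable now, S): a row supported in `supp c` is at distance
`min (pwt row, pwt c - pwt row)` from the code. -/
def OneWordDecode (m : ℕ) : Prop :=
  ∀ c, IsMinWord m c → ∀ r : (Fin m → Bool) → Bool, (∀ v, c v = false → r v = false) →
    distC m r = min (pwt r) (pwt c - pwt r)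

/-- `OneWordMIAt` is a special case of `MassIneqAt` (pure logic). -/
theorem oneWordMIAt_of_massIneqAt (m : ℕ) (K0 : (Fin m → Bool) → Bool) (h : MassIneqAt m K0) :
    OneWordMIAt m K0 := fun _ _ D hD _ => h D hD

end OneWord

/-! ## SC₁ with margin and the even-m degeneracy (ROUND-12 (xi-w)) -/
section Margin

/-- **SC₁ with margin `σ` at `K0`**: `|A ∩ Z| + σ ≤ |A ∖ Z|` for every NONZERO codeword `A` (at odd `m` with `σ = σ_m`: 13 at m = 7, 40 at m = 9,
1093 at m = 15 numerically; equivalent to `failCount (K0 ⊕ A) ≥ failCount K0 + σ`, qn-lit's σ).  Finite check per `m`. -/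
def SCMargin (m σ : ℕ) (K0 : (Fin m → Bool) → Bool) : Prop :=
  ∀ A, IsElim1 m A → pwt A ≠ 0 →
    (univ.filter fun u : Fin m → Bool => A u = true ∧ K0 u = false).card + σ ≤
      (univ.filter fun u : Fin m → Bool => A u = true ∧ K0 u = true).card

/-- SC₁-margin 13 at the symmetric optimum of `C_7` (kit13/scdist.py; provable by orbit counting, S/M). -/
def SCMarginSeven : Prop := ∀ K0 : (Fin 7 → Bool) → Bool, IsOpt1 7 K0 → IsSymPat K0 → SCMargin 7 13 K0

/-- SC₁-margin 40 at the symmetric optimum of `C_9`. -/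
def SCMarginNine : Prop := ∀ K0 : (Fin 9 → Bool) → Bool, IsOpt1 9 K0 → IsSymPat K0 → SCMargin 9 40 K0

/-- Even-m degeneracy at `m = 8` (kit13/scdist.py): the sum of the two optima is a minimum-weight word, and it is
the only nonzero codeword on which SC₁ is tight at the symmetric optimum. -/
def MinWordIsOptDiffEight : Prop :=
  ∀ K0 K1 : (Fin 8 → Bool) → Bool, IsOpt1 8 K0 → IsSymPat K0 → IsOpt1 8 K1 → K1 ≠ K0 →
    IsMinWord 8 (fun u => xor (K0 u) (K1 u))

end Margin

/-! ## Finite facts at m = 14, 15 (kit j277899 / j277896, ROUND-12 KIT 13:30Z) -/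
section DualGenFifteen

/-- The outside dual module of `C_15` at the symmetric optimum is generated by dual words of length ≤ 6
(kit13/outrel_np.py, j277896: rank 24000 / 24000 in 68 s; the certificate is a list of 24000 independent short relations —
a `decide`-style finite check, L). -/
def DualGenOutFifteen : Prop := ∀ K0 : (Fin 15 → Bool) → Bool, IsOpt1 15 K0 → IsSymPat K0 → DualGenOut 15 K0 6

/-- Same at `m = 14` (j277899: rank 11986 / 11986). -/
def DualGenOutFourteen : Prop := ∀ K0 : (Fin 14 → Bool) → Bool, IsOpt1 14 K0 → IsSymPat K0 → DualGenOut 14 K0 6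

end DualGenFifteen

end MassInequality

end Summit.QuantumAdvantage.AdviceFreeQNC0
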